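import Summits.Schanuel.Schanuel.Theorems.DiophantineDichotomyApproximationPropertyDefs
import Summits.Schanuel.Schanuel.Theorems.DiophantineDichotomyApproximationPropertyZeroDimDictionary
import Literature.RingTheory.MvPolynomial.HomogeneousHilbertFunction
import Mathlib.LinearAlgebra.FiniteDimensional.Lemmas
import HarnessLib

/-!
# Stubs `rankOne_interpolation_of_ideg_le` and `closestPoint_clauseFree` of line `orbit-interpolation-determinant` (crux `ApproximationProperty`, stmt-Schanuel-6117)

Crux `stmt-Schanuel-6117` (`Summit.Schanuel.Schanuel.Theses.DiophantineDichotomy.ApproximationProperty`),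
route `DiophantineDichotomy`, line `orbit-interpolation-determinant` (vocabulary:
`DiophantineDichotomyApproximationPropertyDefs.lean`). This file PROVES two registered stubs of the
lead's wave 1:

* `rankOne_interpolation_of_ideg_le` — **the interpolation clause is automatic from degree
  `deg 𝔭 − 1` on**: for a homogeneous prime `𝔭 ⊂ ℚ[x₀, …, x_m]` of rank `1` (a Galois orbit of
  `D = deg 𝔭` points of `ℙᵐ`) and every `δ ≥ D − 1`,
  `dim_ℚ ℚ[x̲]_δ = dim_ℚ 𝔭_δ + deg 𝔭`, i.e. the zeros of `𝔭` impose independent conditions on the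
  forms of degree `δ`. (≤) The evaluation map `ℚ[x̲]_δ → K = ℚ(b̄')` at a normalised zero has kernel
  `𝔭_δ` (`mem_iff_aeval_eq_zero`) and target of dimension `[K:ℚ] = deg 𝔭` (`finrank_eq_ideg`):
  rank–nullity (`finrank_homogeneousSubmodule_le`, valid for every `δ`). (≥) The `deg 𝔭` conjugates
  `σ(b̄)`, `σ : K → ℂ`, are pairwise non-proportional common zeros of `𝔭` (`map_mem_projZeros`,
  `embedding_eq_of_proportional`), so they impose `deg 𝔭` independent conditions in every degree
  `δ ≥ deg 𝔭 − 1` (`ClauseFree.le_hilbert_of_zeros`, a private copy of the registered helper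
  `curveHilbert_zerosImpose` of `…CurveHilbertTelescope.lean`, whose compiled module was not available
  when this file landed).
* `closestPoint_clauseFree` — **the sharp closest-point property without clause hypothesis**:
  `SharpClosestPoint` at level `δ = deg 𝔭 − 1`, where the clause holds by the first stub; the
  exponent `C δ h/ℓ^{1/m} + C' D ((δ+1)(log(2+‖ω‖)+1) + log(D+1))` is bounded by
  `C D h/ℓ^{1/m} + 2C' D² (log(2+‖ω‖)+1)` using `δ ≤ D`, `δ + 1 = D`, `log(D+1) ≤ D`.

Sources: NesterenkoPhilippon2001 (LNM 1752) Ch. 3 §4 (Prop. 4.4, Prop. 4.13), §5 (p. 42);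
Chardin, Bull. SMF 117 (1989) §1 (interpolation on finite sets of points); folklore linear algebra.
-/

noncomputable section

-- `Summit.Schanuel.Schanuel.…` is the mandated summit/sub-problem namespace (single-conjunct summit), hence:
set_option linter.dupNamespace false

attribute [local instance] MvPolynomial.gradedAlgebra

namespace Summit.Schanuel.Schanuel.Cruxes.ApproximationProperty.OrbitInterpolationDeterminant

open Literature.NumberTheory.Transcendental.Nesterenko MvPolynomial
open scoped BigOperators

variable {m : ℕ}

/-! ### Pairwise non-proportional common zeros impose independent conditions in high degree

(Private copy of `CurveHilbert.le_hilbert_of_zeros` from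
`DiophantineDichotomyApproximationPropertyCurveHilbertTelescope.lean`, registered helper
`curveHilbert_zerosImpose`, whose compiled module was not yet available when this file landed.) -/

namespace ClauseFree

section Zeros

variable {N : ℕ} (β : Fin N → (Fin (m + 1) → ℂ))

-- adapted from `CurveHilbert.isHomogeneous_linPQ` (…CurveHilbertTelescope.lean)
/-- A linear form `λ = b_q x_p − b_p x_q` over `ℂ` (vanishing at `b`). [folklore] -/
private theorem isHomogeneous_linPQ (b : Fin (m + 1) → ℂ) (p q : Fin (m + 1)) :
    (C (b q) * X p - C (b p) * X q : MvPolynomial (Fin (m + 1)) ℂ).IsHomogeneous 1 := by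
  have h1 : (C (b q) * X p : MvPolynomial (Fin (m + 1)) ℂ).IsHomogeneous 1 := by
    simpa using (isHomogeneous_C _ (b q)).mul (isHomogeneous_X ℂ p)
  have h2 : (C (b p) * X q : MvPolynomial (Fin (m + 1)) ℂ).IsHomogeneous 1 := by
    simpa using (isHomogeneous_C _ (b p)).mul (isHomogeneous_X ℂ q)
  exact h1.sub h2

-- adapted from `CurveHilbert.exists_form_separating` (…CurveHilbertTelescope.lean)
/-- For pairwise non-proportional non-zero vectors `β₁, …, β_N` and `j + 1 ≥ N`, a complex form of
degree `j` vanishing at all `β_k`, `k ≠ i`, but not at `βᵢ`. [folklore] -/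
private theorem exists_form_separating (hβ0 : ∀ i, β i ≠ 0)
    (hsep : ∀ i k, i ≠ k → ∃ p q, β i p * β k q ≠ β i q * β k p) {j : ℕ} (hj : N ≤ j + 1)
    (i : Fin N) :
    ∃ A : MvPolynomial (Fin (m + 1)) ℂ, A.IsHomogeneous j ∧ eval (β i) A ≠ 0 ∧
      ∀ k, k ≠ i → eval (β k) A = 0 := by
  classical
  -- the linear forms `λ_{ik}`
  have hlam : ∀ k, ∃ lam : MvPolynomial (Fin (m + 1)) ℂ, lam.IsHomogeneous 1 ∧
      (k ≠ i → eval (β i) lam ≠ 0 ∧ eval (β k) lam = 0) := by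
    intro k
    by_cases hk : k = i
    · exact ⟨X 0, isHomogeneous_X ℂ 0, fun h => (h hk).elim⟩
    · obtain ⟨p, q, hpq⟩ := hsep i k (Ne.symm hk)
      refine ⟨C (β k q) * X p - C (β k p) * X q, isHomogeneous_linPQ (β k) p q, fun _ => ⟨?_, ?_⟩⟩
      · simp only [map_sub, map_mul, eval_C, eval_X]
        intro h
        apply hpq
        linear_combination h
      · simp only [map_sub, map_mul, eval_C, eval_X]
        ring
  choose lam hlam1 hlamv using hlam
  obtain ⟨c, hc⟩ := Function.ne_iff.mp (hβ0 i)
  have hN : 1 ≤ N := Nat.succ_le_of_lt i.pos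
  refine ⟨(∏ k ∈ Finset.univ.erase i, lam k) * X c ^ (j + 1 - N), ?_, ?_, ?_⟩
  · have h1 : (∏ k ∈ Finset.univ.erase i, lam k).IsHomogeneous (∑ k ∈ Finset.univ.erase i, 1) :=
      IsHomogeneous.prod _ _ _ fun k _ => hlam1 k
    rw [Finset.sum_const, smul_eq_mul, mul_one, Finset.card_erase_of_mem (Finset.mem_univ i),
      Finset.card_univ, Fintype.card_fin] at h1
    have h2 := h1.mul (isHomogeneous_X_pow (R := ℂ) c (j + 1 - N))
    rwa [show N - 1 + (j + 1 - N) = j by omega] at h2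
  · rw [map_mul, map_pow, eval_X, map_prod]
    refine mul_ne_zero (Finset.prod_ne_zero_iff.mpr fun k hk => ?_) (pow_ne_zero _ hc)
    exact ((hlamv k) (Finset.ne_of_mem_erase hk)).1
  · intro k hk
    rw [map_mul, map_prod, Finset.prod_eq_zero (Finset.mem_erase.mpr ⟨hk, Finset.mem_univ k⟩)
      ((hlamv k) hk).2, zero_mul]

-- adapted from `CurveHilbert.le_hilbert_of_zeros` (…CurveHilbertTelescope.lean)
/-- **`N` pairwise non-proportional common zeros give `H(J; j) ≥ N` for `j ≥ N − 1`.** Let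
`J ⊆ ℚ[x₀, …, x_m]` be an ideal and `β₁, …, β_N ∈ ℂ^{m+1} ∖ 0` pairwise non-proportional vectors at
which every element of `J` vanishes. Then `dim_ℚ ℚ[x̲]_j − dim_ℚ J_j ≥ N` whenever `j + 1 ≥ N`
(the evaluation map `ℚ[x̲]_j → ℂ^N` kills `J_j`, and the `ℂ`-span of its image is everything).
[cite: Chardin1989, §1 (interpolation on finite sets); folklore] -/
private theorem le_hilbert_of_zeros (J : Ideal (Rx m)) (hβ0 : ∀ i, β i ≠ 0)
    (hsep : ∀ i k, i ≠ k → ∃ p q, β i p * β k q ≠ β i q * β k p)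
    (hzero : ∀ i, ∀ f ∈ J, aeval (β i) f = 0) {j : ℕ} (hj : N ≤ j + 1) :
    N ≤ Module.finrank ℚ (homogeneousSubmodule (Fin (m + 1)) ℚ j) -
      Module.finrank ℚ (Literature.RingTheory.MvPolynomial.idealDegree J j) := by
  classical
  set V : Submodule ℚ (Rx m) := homogeneousSubmodule (Fin (m + 1)) ℚ j with hV
  haveI : Module.Finite ℚ V :=
    Literature.RingTheory.MvPolynomial.finite_homogeneousSubmodule (K := ℚ) (σ := Fin (m + 1)) j
  -- the evaluation map
  let ev : Rx m →ₗ[ℚ] (Fin N → ℂ) :=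
    LinearMap.pi fun i => ((aeval (β i) : Rx m →ₐ[ℚ] ℂ).toLinearMap)
  have ev_apply : ∀ (f : Rx m) (i : Fin N), ev f i = aeval (β i) f := fun f i => rfl
  let evV : V →ₗ[ℚ] (Fin N → ℂ) := ev.comp V.subtype
  -- its kernel contains `J_j`
  have hle : Literature.RingTheory.MvPolynomial.idealDegree J j ≤ V :=
    Literature.RingTheory.MvPolynomial.idealDegree_le_homogeneousSubmodule J j
  have hker : (Literature.RingTheory.MvPolynomial.idealDegree J j).comap V.subtype ≤
      LinearMap.ker evV := by
    intro x hx
    rw [LinearMap.mem_ker]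
    funext i
    change ev x.1 i = 0
    rw [ev_apply]
    exact hzero i x.1 (Literature.RingTheory.MvPolynomial.mem_idealDegree.mp hx).1
  have hk : Module.finrank ℚ (Literature.RingTheory.MvPolynomial.idealDegree J j) ≤
      Module.finrank ℚ (LinearMap.ker evV) := by
    rw [← (Submodule.comapSubtypeEquivOfLe hle).finrank_eq]
    exact Submodule.finrank_mono hker
  have hrn := LinearMap.finrank_range_add_finrank_ker evV
  -- the range has `ℚ`-dimension at least `N`
  set Rg : Submodule ℚ (Fin N → ℂ) := LinearMap.range evV with hRg
  set S : Submodule ℂ (Fin N → ℂ) := Submodule.span ℂ (Rg : Set (Fin N → ℂ)) with hS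
  -- (1) `dim_ℂ S ≤ dim_ℚ Rg`
  have hS_le : Module.finrank ℂ S ≤ Module.finrank ℚ Rg := by
    let b := Module.finBasis ℚ Rg
    have hsub : (Rg : Set (Fin N → ℂ)) ⊆
        Submodule.span ℂ (Set.range fun i => (b i : Fin N → ℂ)) := by
      intro x hx
      have hx' : (⟨x, hx⟩ : Rg) = ∑ i, b.repr ⟨x, hx⟩ i • b i := (b.sum_repr ⟨x, hx⟩).symm
      have hx'' : x = ∑ i, ((b.repr ⟨x, hx⟩ i : ℚ) : ℂ) • (b i : Fin N → ℂ) := by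
        have := congrArg Subtype.val hx'
        simp only [Submodule.coe_sum, Submodule.coe_smul] at this
        refine this.trans (Finset.sum_congr rfl fun i _ => ?_)
        ext k
        simp [Rat.smul_def]
      rw [hx'']
      exact Submodule.sum_mem _ fun i _ =>
        Submodule.smul_mem _ _ (Submodule.subset_span ⟨i, rfl⟩)
    calc Module.finrank ℂ S
        ≤ Module.finrank ℂ (Submodule.span ℂ (Set.range fun i => (b i : Fin N → ℂ))) :=
          Submodule.finrank_mono (Submodule.span_le.mpr hsub)
      _ ≤ Fintype.card (Fin (Module.finrank ℚ Rg)) := finrank_range_le_card _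
      _ = Module.finrank ℚ Rg := Fintype.card_fin _
  -- (2) `S = ⊤`: complex forms of degree `j` evaluate into `S`, and they separate the points
  have hmono : ∀ d : Fin (m + 1) →₀ ℕ, (monomial d (1 : ℚ) : Rx m) ∈ V →
      (fun i => eval (β i) (monomial d (1 : ℂ))) ∈ S := by
    intro d hd
    have hmem : ev (monomial d (1 : ℚ)) ∈ Rg := ⟨⟨monomial d 1, hd⟩, rfl⟩
    have heq : (fun i => eval (β i) (monomial d (1 : ℂ))) = ev (monomial d (1 : ℚ)) := by
      funext i
      rw [ev_apply, aeval_def, ← eval_map, map_monomial, RingHom.map_one]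
    rw [heq]
    exact Submodule.subset_span hmem
  have hformS : ∀ G : MvPolynomial (Fin (m + 1)) ℂ, G.IsHomogeneous j →
      (fun i => eval (β i) G) ∈ S := by
    intro G hG
    have hGsum : (fun i => eval (β i) G) =
        ∑ d ∈ G.support, coeff d G • fun i => eval (β i) (monomial d (1 : ℂ)) := by
      funext i
      conv_lhs => rw [G.as_sum, map_sum]
      simp only [Finset.sum_apply, Pi.smul_apply, smul_eq_mul]
      refine Finset.sum_congr rfl fun d _ => ?_
      rw [show monomial d (coeff d G) = C (coeff d G) * monomial d 1 by
        rw [C_mul_monomial, mul_one], map_mul, eval_C]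
    rw [hGsum]
    refine Submodule.sum_mem _ fun d hd => Submodule.smul_mem _ _ (hmono d ?_)
    have hdeg := hG (mem_support_iff.mp hd)
    exact isHomogeneous_monomial _ (by rw [Finsupp.degree_eq_weight_one]; exact hdeg)
  have htop : (⊤ : Submodule ℂ (Fin N → ℂ)) ≤ S := by
    have hsingle : ∀ i, (Pi.single i 1 : Fin N → ℂ) ∈ S := by
      intro i
      obtain ⟨A, hA, hAi, hAk⟩ := exists_form_separating β hβ0 hsep hj i
      have hmem := Submodule.smul_mem S (eval (β i) A)⁻¹ (hformS A hA)
      have heq : (eval (β i) A)⁻¹ • (fun k => eval (β k) A) = Pi.single i 1 := by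
        funext k
        by_cases hki : k = i
        · subst hki
          simp [hAi]
        · simp [hAk k hki, hki]
      rwa [heq] at hmem
    intro x _
    rw [← Finset.univ_sum_single x]
    refine Submodule.sum_mem _ fun i _ => ?_
    rw [show Pi.single i (x i) = x i • (Pi.single i 1 : Fin N → ℂ) by
      rw [← Pi.single_smul, smul_eq_mul, mul_one]]
    exact Submodule.smul_mem _ _ (hsingle i)
  have hS_ge : N ≤ Module.finrank ℂ S := by
    have h := Submodule.finrank_mono htop
    rw [finrank_top, Module.finrank_fin_fun] at h
    exact h
  -- assemble
  have hR : N ≤ Module.finrank ℚ Rg := hS_ge.trans hS_le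
  have h1 : N + Module.finrank ℚ (Literature.RingTheory.MvPolynomial.idealDegree J j) ≤
      Module.finrank ℚ V :=
    calc N + Module.finrank ℚ (Literature.RingTheory.MvPolynomial.idealDegree J j)
        ≤ Module.finrank ℚ Rg + Module.finrank ℚ (LinearMap.ker evV) := add_le_add hR hk
      _ = Module.finrank ℚ V := hrn
  exact Nat.le_sub_of_add_le h1

end Zeros

end ClauseFree

/-! ### The two inequalities, for a given normalised zero -/

section NormalisedZero

variable {𝔭 : Ideal (Rx m)}

/-- **(≤) `dim ℚ[x̲]_δ ≤ dim 𝔭_δ + deg 𝔭` for every `δ`**: the evaluation map `ℚ[x̲]_δ → K = ℚ(b̄')`,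
`G ↦ G(b̄)`, has kernel `𝔭_δ` and target of `ℚ`-dimension `deg 𝔭`.
[cite: NesterenkoPhilippon2001, Ch. 3 §5 (p. 42)] -/
theorem finrank_homogeneousSubmodule_le (h𝔭 : 𝔭.IsPrime)
    (hhom : 𝔭.IsHomogeneous (homogeneousSubmodule (Fin (m + 1)) ℚ)) (hunm : IsUnmixedOfRank 𝔭 1)
    {b' : Fin (m + 1) → ℂ} (hb' : b' ∈ projZeros 𝔭) {j : Fin (m + 1)} (hj : b' j = 1)
    [NumberField ↥(IntermediateField.adjoin ℚ (Set.range b'))]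
    {b : Fin (m + 1) → ↥(IntermediateField.adjoin ℚ (Set.range b'))} (hb : ∀ k, (b k : ℂ) = b' k)
    (δ : ℕ) :
    Module.finrank ℚ ↥(homogeneousSubmodule (Fin (m + 1)) ℚ δ) ≤
      Module.finrank ℚ ↥(homogeneousSubmodule (Fin (m + 1)) ℚ δ ⊓ 𝔭.restrictScalars ℚ) +
        ideg 𝔭 1 := by
  classical
  set W : Submodule ℚ (Rx m) := homogeneousSubmodule (Fin (m + 1)) ℚ δ with hW
  haveI : FiniteDimensional ℚ ↥W := Module.Finite.iff_fg.mpr (homogeneousSubmodule_fg _ _ δ)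
  set ev : ↥W →ₗ[ℚ] ↥(IntermediateField.adjoin ℚ (Set.range b')) :=
    (aeval b).toLinearMap.comp W.subtype with hev
  have hkerW : LinearMap.ker ev = Submodule.comap W.subtype (W ⊓ 𝔭.restrictScalars ℚ) := by
    ext ⟨G, hG⟩
    have hG' : G.IsHomogeneous δ := (mem_homogeneousSubmodule δ G).mp hG
    simp only [LinearMap.mem_ker, hev, LinearMap.comp_apply, Submodule.subtype_apply,
      AlgHom.toLinearMap_apply, Submodule.mem_comap, Submodule.mem_inf, hG, true_and,
      Submodule.restrictScalars_mem]
    exact (mem_iff_aeval_eq_zero h𝔭 hhom hunm hb' hj hb hG').symm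
  have hfr : Module.finrank ℚ ↥(LinearMap.ker ev) =
      Module.finrank ℚ ↥(W ⊓ 𝔭.restrictScalars ℚ) := by
    rw [hkerW]
    exact LinearEquiv.finrank_eq (Submodule.comapSubtypeEquivOfLe inf_le_left)
  have hrn := LinearMap.finrank_range_add_finrank_ker ev
  have hrange : Module.finrank ℚ ↥(LinearMap.range ev) ≤ ideg 𝔭 1 := by
    rw [← finrank_eq_ideg h𝔭 hhom hunm hb' hj hb]
    exact Submodule.finrank_le _
  calc Module.finrank ℚ ↥W
      = Module.finrank ℚ ↥(LinearMap.range ev) + Module.finrank ℚ ↥(LinearMap.ker ev) := hrn.symm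
    _ = Module.finrank ℚ ↥(LinearMap.range ev) +
          Module.finrank ℚ ↥(W ⊓ 𝔭.restrictScalars ℚ) := by rw [hfr]
    _ ≤ ideg 𝔭 1 + Module.finrank ℚ ↥(W ⊓ 𝔭.restrictScalars ℚ) := Nat.add_le_add_right hrange _
    _ = Module.finrank ℚ ↥(W ⊓ 𝔭.restrictScalars ℚ) + ideg 𝔭 1 := add_comm _ _

/-- **(≥) `dim 𝔭_δ + deg 𝔭 ≤ dim ℚ[x̲]_δ` for `δ + 1 ≥ deg 𝔭`**: the `deg 𝔭 = [K:ℚ]` conjugates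
`σ(b̄)` of a normalised zero are pairwise non-proportional common zeros of `𝔭`, and `N` pairwise
non-proportional points impose independent conditions on the forms of degree `≥ N − 1`.
[cite: Chardin1989, §1; folklore] -/
theorem finrank_inf_add_ideg_le (h𝔭 : 𝔭.IsPrime)
    (hhom : 𝔭.IsHomogeneous (homogeneousSubmodule (Fin (m + 1)) ℚ)) (hunm : IsUnmixedOfRank 𝔭 1)
    {b' : Fin (m + 1) → ℂ} (hb' : b' ∈ projZeros 𝔭) {j : Fin (m + 1)} (hj : b' j = 1)
    [NumberField ↥(IntermediateField.adjoin ℚ (Set.range b'))]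
    {b : Fin (m + 1) → ↥(IntermediateField.adjoin ℚ (Set.range b'))} (hb : ∀ k, (b k : ℂ) = b' k)
    {δ : ℕ} (hδ : ideg 𝔭 1 ≤ δ + 1) :
    Module.finrank ℚ ↥(homogeneousSubmodule (Fin (m + 1)) ℚ δ ⊓ 𝔭.restrictScalars ℚ) +
        ideg 𝔭 1 ≤
      Module.finrank ℚ ↥(homogeneousSubmodule (Fin (m + 1)) ℚ δ) := by
  classical
  have hbj : b j = 1 := Subtype.ext (by rw [hb, hj]; rfl)
  -- enumerate the `deg 𝔭` complex embeddings of `K`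
  have hcard : Fintype.card (↥(IntermediateField.adjoin ℚ (Set.range b')) →+* ℂ) = ideg 𝔭 1 := by
    rw [NumberField.Embeddings.card, finrank_eq_ideg h𝔭 hhom hunm hb' hj hb]
  set e : (↥(IntermediateField.adjoin ℚ (Set.range b')) →+* ℂ) ≃ Fin (ideg 𝔭 1) :=
    Fintype.equivFinOfCardEq hcard with he
  set β : Fin (ideg 𝔭 1) → (Fin (m + 1) → ℂ) := fun i k => e.symm i (b k) with hβ
  have hβ0 : ∀ i, β i ≠ 0 := fun i => (map_mem_projZeros hb' hj hb (e.symm i)).1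
  have hsep : ∀ i k, i ≠ k → ∃ p q, β i p * β k q ≠ β i q * β k p := by
    intro i k hik
    have hne : β i ≠ β k := fun heq => hik (e.symm.injective
      (embedding_eq_of_proportional hj hb (e.symm i) (e.symm k) 1
        (by simpa only [hβ, one_mul] using heq)))
    obtain ⟨p, hp⟩ := Function.ne_iff.mp hne
    refine ⟨p, j, ?_⟩
    simpa only [hβ, hbj, map_one, mul_one, one_mul] using hp
  have hzero : ∀ i, ∀ f ∈ 𝔭, aeval (β i) f = 0 := fun i f hf =>
    (map_mem_projZeros hb' hj hb (e.symm i)).2 f hf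
  have himp := ClauseFree.le_hilbert_of_zeros β 𝔭 hβ0 hsep hzero hδ
  have hI : Literature.RingTheory.MvPolynomial.idealDegree 𝔭 δ =
      homogeneousSubmodule (Fin (m + 1)) ℚ δ ⊓ 𝔭.restrictScalars ℚ := inf_comm _ _
  have hle := Literature.RingTheory.MvPolynomial.finrank_idealDegree_le 𝔭 δ
  rw [hI] at himp hle
  omega

end NormalisedZero

/-! ### The registered stubs -/

/-- **Stub `rankOne_interpolation_of_ideg_le`** (crux `stmt-Schanuel-6117`, line
`orbit-interpolation-determinant`): the zeros of a homogeneous prime `𝔭 ⊂ ℚ[x₀, …, x_m]` of rank `1`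
impose independent conditions on the forms of every degree `δ ≥ deg 𝔭 − 1`:
`dim_ℚ ℚ[x̲]_δ = dim_ℚ 𝔭_δ + deg 𝔭`. [cite: NesterenkoPhilippon2001, Ch. 3 §5 (p. 42); Chardin1989, §1] -/
theorem rankOne_interpolation_of_ideg_le : ∀ (m : ℕ) (𝔭 : Ideal (Rx m)) (δ : ℕ), 𝔭.IsPrime →
    𝔭.IsHomogeneous (homogeneousSubmodule (Fin (m + 1)) ℚ) → IsUnmixedOfRank 𝔭 1 →
    ideg 𝔭 1 ≤ δ + 1 →
    Module.finrank ℚ ↥(homogeneousSubmodule (Fin (m + 1)) ℚ δ) =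
      Module.finrank ℚ ↥(homogeneousSubmodule (Fin (m + 1)) ℚ δ ⊓ 𝔭.restrictScalars ℚ) +
        ideg 𝔭 1 := by
  intro m 𝔭 δ h𝔭 hhom hunm hδ
  -- a normalised zero `b̄'`, `b'_j = 1`, and its field `K = ℚ(b̄')`
  obtain ⟨β₀, hβ₀⟩ := projZeros_nonempty' h𝔭 hhom hunm
  obtain ⟨j, hj0⟩ := Function.ne_iff.mp hβ₀.1
  have hb' : (β₀ j)⁻¹ • β₀ ∈ projZeros 𝔭 :=
    Literature.NumberTheory.Transcendental.PhilipponMain.smul_mem_projZeros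
      (fun P hP k => homogeneousComponent_mem_of_mem hhom hP k) hβ₀ (inv_ne_zero hj0)
  have hj : ((β₀ j)⁻¹ • β₀) j = 1 := by
    rw [Pi.smul_apply, smul_eq_mul, inv_mul_cancel₀ hj0]
  haveI := numberField_adjoin h𝔭 hhom hunm hb' hj
  let b : Fin (m + 1) → ↥(IntermediateField.adjoin ℚ (Set.range ((β₀ j)⁻¹ • β₀))) := fun k =>
    ⟨((β₀ j)⁻¹ • β₀) k, IntermediateField.subset_adjoin ℚ _ ⟨k, rfl⟩⟩
  have hb : ∀ k, (b k : ℂ) = ((β₀ j)⁻¹ • β₀) k := fun k => rfl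
  exact le_antisymm (finrank_homogeneousSubmodule_le h𝔭 hhom hunm hb' hj hb δ)
    (finrank_inf_add_ideg_le h𝔭 hhom hunm hb' hj hb hδ)

/-- **Stub `closestPoint_clauseFree`** (crux `stmt-Schanuel-6117`, line
`orbit-interpolation-determinant`): the sharp closest-point property with NO interpolation
hypothesis — `SharpClosestPoint` at level `δ = deg 𝔭 − 1`, where the clause is automatic
(`rankOne_interpolation_of_ideg_le`), with the exponent simplified to
`C deg 𝔭 · h(𝔭)/ℓ^{1/m} + C' (deg 𝔭)² (log(2+‖ω‖) + 1)`.
[cite: NesterenkoPhilippon2001, Ch. 3 §4 (Prop. 4.13)] -/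
theorem closestPoint_clauseFree : SharpClosestPoint → ∀ m : ℕ, 1 ≤ m → ∃ C : ℝ, 0 < C ∧
    ∃ ℓ₀ : ℕ, ∀ ℓ : ℕ, ℓ₀ ≤ ℓ → ∃ C' : ℝ, 0 < C' ∧
    ∀ (𝔭 : Ideal (Rx m)) (ω : Fin m → ℂ), 𝔭.IsPrime →
      𝔭.IsHomogeneous (homogeneousSubmodule (Fin (m + 1)) ℚ) → IsUnmixedOfRank 𝔭 1 →
      ∃ β ∈ projZeros 𝔭,
        projDist (Fin.cons 1 ω) β ^ ℓ ≤
          iabs 𝔭 1 (Fin.cons 1 ω) *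
            Real.exp (C * ideg 𝔭 1 * iheight 𝔭 1 / (ℓ : ℝ) ^ (1 / (m : ℝ)) +
              C' * (ideg 𝔭 1 : ℝ) ^ 2 * (Real.log (2 + ‖ω‖) + 1)) := by
  intro hSCP m hm
  obtain ⟨C, hC, ℓ₀, hℓ⟩ := hSCP m hm
  refine ⟨C, hC, ℓ₀, fun ℓ hℓ₀ => ?_⟩
  obtain ⟨C', hC', hmain⟩ := hℓ ℓ hℓ₀
  refine ⟨2 * C', mul_pos two_pos hC', fun 𝔭 ω h𝔭 hhom hunm => ?_⟩
  have hD : 1 ≤ ideg 𝔭 1 := (chowForm_facts h𝔭 hhom hunm).2.2.2.1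
  have hclause := rankOne_interpolation_of_ideg_le m 𝔭 (ideg 𝔭 1 - 1) h𝔭 hhom hunm (by omega)
  obtain ⟨β, hβ, hle⟩ := hmain 𝔭 (ideg 𝔭 1 - 1) ω h𝔭 hhom hunm hclause
  refine ⟨β, hβ, hle.trans (mul_le_mul_of_nonneg_left (Real.exp_le_exp.mpr ?_) (iabs_nonneg _ _ _))⟩
  -- comparison of the exponents
  set D : ℝ := (ideg 𝔭 1 : ℝ) with hDdef
  set h : ℝ := iheight 𝔭 1 with hhdef
  set L : ℝ := Real.log (2 + ‖ω‖) with hLdef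
  set r : ℝ := (ℓ : ℝ) ^ (1 / (m : ℝ)) with hrdef
  have hδD : ((ideg 𝔭 1 - 1 : ℕ) : ℝ) + 1 = D := by
    rw [hDdef]; exact_mod_cast Nat.sub_add_cancel hD
  have hδle : ((ideg 𝔭 1 - 1 : ℕ) : ℝ) ≤ D := by
    rw [hDdef]; exact_mod_cast Nat.sub_le _ _
  have hD1 : (1 : ℝ) ≤ D := by rw [hDdef]; exact_mod_cast hD
  have hh : 0 ≤ h := height_nonneg _
  have hL : 0 ≤ L := Real.log_nonneg (by linarith [norm_nonneg ω])
  have hr : 0 ≤ r := Real.rpow_nonneg (Nat.cast_nonneg _) _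
  have hlog : Real.log (D + 1) ≤ D := by
    have := Real.log_le_sub_one_of_pos (by linarith : (0 : ℝ) < D + 1)
    linarith
  have h1 : C * ((ideg 𝔭 1 - 1 : ℕ) : ℝ) * h / r ≤ C * D * h / r :=
    div_le_div_of_nonneg_right (by nlinarith [mul_nonneg hC.le hh]) hr
  have h2 : C' * D * ((((ideg 𝔭 1 - 1 : ℕ) : ℝ) + 1) * (L + 1) + Real.log (D + 1)) ≤
      2 * C' * D ^ 2 * (L + 1) := by
    rw [hδD]
    have hin : D * (L + 1) + Real.log (D + 1) ≤ 2 * D * (L + 1) := by nlinarith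
    have := mul_le_mul_of_nonneg_left hin (mul_nonneg hC'.le (by linarith : (0 : ℝ) ≤ D))
    nlinarith
  linarith
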